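import Summits.KontsevichZagierPeriods.KontsevichZagierPeriods.Theorems.TerasomaMultiplicationMultiplicationAccessibleCornerStokesTheta1Aux

/-!
# `MultiplicationAccessible` (stmt-KontsevichZagierPeriods-12305), line `shifted-family-prime-sieve`:
the `θ₁`-direction Newton–Leibniz move of the corner Stokes at `p = 3` (`cornerStokesTheta1`)

The Liouville rotation flow proves the shifted Gauss triplication by Stokes on the chart domain
`W = {(θ₁, θ₂, y, v)}`; the closed 3-form has components `c₀, …, c₃` and
`dΛ = 0 ⟺ ∂θ₁c₀ − ∂θ₂c₁ + ∂_y c₂ − ∂_v c₃ = 0`. This file produces the `θ₁`-term: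
`N = [W, ∂θ₁c₀]` is a period representation with `[N] ∈ KZ.relations`. Over the base
`B₁ = {(θ₂, y, v)}` the `θ₁`-fibre of `W` is the interval `(a, b)`, `a = max 0 (1 − θ₂ − 1/y)`,
`b = min (1 − θ₂) (1/y)`; the primitive `c₀` is continuous on the closed fibre and vanishes at
both ends (`θ₁ = 0`; `t₀ = 0`; `θ₀ = 0`; `t₁ = 0`), so ONE rule-3 move
(`KZ.exists_band_newtonLeibniz`, `θ₁` as the last coordinate) gives `[band, ∂θ₁c₀] ∼ [B₁, 0] ∼ 0`; opening the fibres
(`KZ.of_sub_of_restrict_openBand_mem_relations`) and permuting the coordinates back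
(`KZ.of_sub_of_reindex_mem_relations`) yields `N` with `N.domain = W`.
References: Kontsevich–Zagier 2001 §1.2 rule (3); Andrews–Askey–Roy 1999 pp. 30–31.
-/

noncomputable section

open MeasureTheory Set Real
open scoped BigOperators
open Literature.NumberTheory.Transcendental
open Literature.NumberTheory.Transcendental.KZ
open Literature.ModelTheory.ExponentialFields (IsSemialgebraic isSemialgebraic_setOf_eval_pos
  isSemialgebraic_setOf_eval_lt)
open MvPolynomial (aeval X C)

namespace Summit.KontsevichZagierPeriods.TerasomaMultiplication.MultiplicationAccessible

namespace CornerTheta1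

/-- **`c₀` vanishes at both ends of every closed `θ₁`-fibre**: at `θ₁ = 0` (factor `θ₁`), at
`θ₁ = 1 − θ₂ − 1/y` (`t₀ = 0`, all `M_k = 0`), at `θ₁ = 1 − θ₂` (`θ₀ = 0`, `K = 0`) and at
`θ₁ = 1/y` (`t₁ = 0`, all `M_k = 0`). [folklore] -/
theorem c0_cons_ends {x s : ℚ} (hx : 2 ≤ x) (hs : 3 ≤ s) {Z H K M0 M1 M2 P c0 : (Fin 4 → ℝ) → ℝ}
    (hK : ∀ w, K w = ((1 - w 0 - w 1) * w 0 * w 1) ^ ((s:ℝ) - 1))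
    (hM0 : ∀ w, M0 w = (1 - w 2 * (1 - w 0 - w 1)) ^ (x:ℝ) * (1 - w 2 * w 0) ^ ((x:ℝ) - 2/3) *
      (1 - w 2 * w 1) ^ ((x:ℝ) - 1/3))
    (hM1 : ∀ w, M1 w = (1 - w 2 * (1 - w 0 - w 1)) ^ ((x:ℝ) - 1/3) * (1 - w 2 * w 0) ^ (x:ℝ) *
      (1 - w 2 * w 1) ^ ((x:ℝ) - 2/3))
    (hM2 : ∀ w, M2 w = (1 - w 2 * (1 - w 0 - w 1)) ^ ((x:ℝ) - 2/3) * (1 - w 2 * w 0) ^ ((x:ℝ) - 1/3) *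
      (1 - w 2 * w 1) ^ (x:ℝ))
    (hP : ∀ w, P w = (w 3) ^ (3 * (x:ℝ) - 1) * (1 - w 3 * Z w) ^ (3 * (s:ℝ) - 1) * H w ^ (3 * (s:ℝ)) *
      K w)
    (hc0 : ∀ w, c0 w = -(P w * w 0 * ((1 - w 0 - w 1) * M0 w - (1 - w 0) * M1 w + w 1 * M2 w) / w 2))
    {q : Fin 3 → ℝ} (hy : 0 < q 1) :
    c0 (Fin.cons (max 0 (1 - q 0 - (q 1)⁻¹)) q) = 0 ∧ c0 (Fin.cons (min (1 - q 0) (q 1)⁻¹) q) = 0 := by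
  have c1 : ∀ t : ℝ, (Fin.cons t q : Fin 4 → ℝ) 1 = q 0 := fun _ => rfl
  have c2 : ∀ t : ℝ, (Fin.cons t q : Fin 4 → ℝ) 2 = q 1 := fun _ => rfl
  have c3 : ∀ t : ℝ, (Fin.cons t q : Fin 4 → ℝ) 3 = q 2 := fun _ => rfl
  have hr : q 1 * (q 1)⁻¹ = 1 := mul_inv_cancel₀ hy.ne'
  have hx' : (2:ℝ) ≤ x := by exact_mod_cast hx
  have hs' : (3:ℝ) ≤ s := by exact_mod_cast hs
  have e0 : (x:ℝ) ≠ 0 := by linarith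
  have e1 : (x:ℝ) - 1/3 ≠ 0 := by linarith
  have e2 : (x:ℝ) - 2/3 ≠ 0 := by linarith
  have e3 : (s:ℝ) - 1 ≠ 0 := by linarith
  constructor
  · rcases le_total (1 - q 0 - (q 1)⁻¹) 0 with h | h
    · rw [max_eq_left h, hc0]; simp
    · rw [max_eq_right h, hc0, hM0, hM1, hM2]
      simp only [Fin.cons_zero, c1, c2]
      have ht0 : 1 - q 1 * (1 - (1 - q 0 - (q 1)⁻¹) - q 0) = 0 := by
        rw [show 1 - (1 - q 0 - (q 1)⁻¹) - q 0 = (q 1)⁻¹ by ring, hr]; ring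
      rw [ht0, Real.zero_rpow e0, Real.zero_rpow e1, Real.zero_rpow e2]; ring
  · rcases le_total (1 - q 0) (q 1)⁻¹ with h | h
    · rw [min_eq_left h, hc0, hP, hK]
      simp only [Fin.cons_zero, c1]
      rw [show 1 - (1 - q 0) - q 0 = (0:ℝ) by ring, zero_mul, zero_mul, Real.zero_rpow e3]; ring
    · rw [min_eq_right h, hc0, hM0, hM1, hM2]
      simp only [Fin.cons_zero, c1, c2]
      have ht1 : 1 - q 1 * (q 1)⁻¹ = 0 := by rw [hr]; ring
      rw [ht1, Real.zero_rpow e0, Real.zero_rpow e1, Real.zero_rpow e2]; ring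

/-- **`c₀` is continuous on the closed `θ₁`-fibres** over `B₁` (all real powers have non-negative
exponent and bases continuous in `θ₁`; `S > 0` on the closed fibre). [folklore] -/
theorem continuousOn_c0_cons {x s : ℚ} (hx : 2 ≤ x) (hs : 3 ≤ s)
    {Z S H K M0 M1 M2 P c0 : (Fin 4 → ℝ) → ℝ}
    (hZ : ∀ w, Z w = ((1 - w 2 * (1 - w 0 - w 1)) * (1 - w 2 * w 0) * (1 - w 2 * w 1)) ^ ((1:ℝ)/3))
    (hS : ∀ w, S w = 1 - w 2 * ((1 - w 0 - w 1) * w 0 + (1 - w 0 - w 1) * w 1 + w 0 * w 1) +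
      (w 2) ^ 2 * ((1 - w 0 - w 1) * w 0 * w 1))
    (hH : ∀ w, H w = (1 + Z w + Z w ^ 2) / S w)
    (hK : ∀ w, K w = ((1 - w 0 - w 1) * w 0 * w 1) ^ ((s:ℝ) - 1))
    (hM0 : ∀ w, M0 w = (1 - w 2 * (1 - w 0 - w 1)) ^ (x:ℝ) * (1 - w 2 * w 0) ^ ((x:ℝ) - 2/3) *
      (1 - w 2 * w 1) ^ ((x:ℝ) - 1/3))
    (hM1 : ∀ w, M1 w = (1 - w 2 * (1 - w 0 - w 1)) ^ ((x:ℝ) - 1/3) * (1 - w 2 * w 0) ^ (x:ℝ) *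
      (1 - w 2 * w 1) ^ ((x:ℝ) - 2/3))
    (hM2 : ∀ w, M2 w = (1 - w 2 * (1 - w 0 - w 1)) ^ ((x:ℝ) - 2/3) * (1 - w 2 * w 0) ^ ((x:ℝ) - 1/3) *
      (1 - w 2 * w 1) ^ (x:ℝ))
    (hP : ∀ w, P w = (w 3) ^ (3 * (x:ℝ) - 1) * (1 - w 3 * Z w) ^ (3 * (s:ℝ) - 1) * H w ^ (3 * (s:ℝ)) *
      K w)
    (hc0 : ∀ w, c0 w = -(P w * w 0 * ((1 - w 0 - w 1) * M0 w - (1 - w 0) * M1 w + w 1 * M2 w) / w 2))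
    {q : Fin 3 → ℝ} (hq : 0 < q 0 ∧ q 0 < 1 ∧ 0 < q 1 ∧ q 1 * q 0 < 1 ∧ q 1 * (1 - q 0) < 2 ∧ 0 < q 2 ∧ q 2 < 1) :
    ContinuousOn (fun t : ℝ => c0 (Fin.cons t q))
      (Icc (max 0 (1 - q 0 - (q 1)⁻¹)) (min (1 - q 0) (q 1)⁻¹)) := by
  set J := Icc (max 0 (1 - q 0 - (q 1)⁻¹)) (min (1 - q 0) (q 1)⁻¹) with hJ
  have c1 : ∀ t : ℝ, (Fin.cons t q : Fin 4 → ℝ) 1 = q 0 := fun _ => rfl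
  have c2 : ∀ t : ℝ, (Fin.cons t q : Fin 4 → ℝ) 2 = q 1 := fun _ => rfl
  have c3 : ∀ t : ℝ, (Fin.cons t q : Fin 4 → ℝ) 3 = q 2 := fun _ => rfl
  have hx' : (2:ℝ) ≤ x := by exact_mod_cast hx
  have hs' : (3:ℝ) ≤ s := by exact_mod_cast hs
  have hy : 0 < q 1 := hq.2.2.1
  have ht0 : Continuous fun t : ℝ => 1 - q 1 * (1 - t - q 0) := by fun_prop
  have ht1 : Continuous fun t : ℝ => 1 - q 1 * t := by fun_prop
  have hZc : ContinuousOn (fun t : ℝ => ((1 - q 1 * (1 - t - q 0)) * (1 - q 1 * t) * (1 - q 1 * q 0)) ^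
      ((1:ℝ)/3)) J :=
    ((ht0.mul ht1).mul continuous_const).continuousOn.rpow_const fun t _ => Or.inr (by norm_num)
  have hSc : Continuous fun t : ℝ => 1 - q 1 * ((1 - t - q 0) * t + (1 - t - q 0) * q 0 + t * q 0) +
      q 1 ^ 2 * ((1 - t - q 0) * t * q 0) := by fun_prop
  have hSne : ∀ t ∈ J, 1 - q 1 * ((1 - t - q 0) * t + (1 - t - q 0) * q 0 + t * q 0) +
      q 1 ^ 2 * ((1 - t - q 0) * t * q 0) ≠ 0 := by
    intro t ht
    have hsg := band_sign (w := Fin.cons t q) hq ht.1 ht.2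
    simp only [Fin.cons_zero, c1, c2] at hsg
    obtain ⟨-, -, -, -, -, -, hu⟩ := hsg
    have key : q 1 * (1 - q 1 * ((1 - t - q 0) * t + (1 - t - q 0) * q 0 + t * q 0) +
        q 1 ^ 2 * ((1 - t - q 0) * t * q 0)) =
        1 - (1 - q 1 * (1 - t - q 0)) * (1 - q 1 * t) * (1 - q 1 * q 0) := by ring
    intro h0
    rw [h0, mul_zero] at key
    linarith
  have hHc := (((continuousOn_const (c := (1:ℝ))).add hZc).add (hZc.pow 2)).div hSc.continuousOn hSne
  have hRc := hHc.rpow_const (p := 3 * (s:ℝ)) fun t _ => Or.inr (by linarith)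
  have hQc := ((continuousOn_const (c := (1:ℝ))).sub ((continuousOn_const (c := q 2)).mul hZc)).rpow_const
    (p := 3 * (s:ℝ) - 1)
    fun t _ => Or.inr (by linarith)
  have hKc := ((by fun_prop : Continuous fun t : ℝ => (1 - t - q 0) * t * q 0).continuousOn (s := J)).rpow_const
    (p := (s:ℝ) - 1) fun t _ => Or.inr (by linarith)
  have hMc : ∀ {α β : ℝ} (γ : ℝ), 0 ≤ α → 0 ≤ β → ContinuousOn (fun t : ℝ => (1 - q 1 * (1 - t - q 0)) ^ α *
      (1 - q 1 * t) ^ β * (1 - q 1 * q 0) ^ γ) J := fun γ hα hβ =>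
    ((ht0.continuousOn.rpow_const fun t _ => Or.inr hα).mul
      (ht1.continuousOn.rpow_const fun t _ => Or.inr hβ)).mul continuousOn_const
  have hPc := (((continuousOn_const (c := q 2 ^ (3 * (x:ℝ) - 1))).mul hQc).mul hRc).mul hKc
  have hθ : Continuous fun t : ℝ => 1 - t - q 0 := by fun_prop
  have h1t : Continuous fun t : ℝ => 1 - t := by fun_prop
  have hBc := ((hθ.continuousOn.mul (hMc ((x:ℝ) - 1/3) (by linarith : (0:ℝ) ≤ x) (by linarith : (0:ℝ) ≤ x - 2/3))).sub
    (h1t.continuousOn.mul (hMc ((x:ℝ) - 2/3) (by linarith : (0:ℝ) ≤ x - 1/3) (by linarith : (0:ℝ) ≤ x)))).add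
    ((continuousOn_const (c := q 0)).mul (hMc (x:ℝ) (by linarith : (0:ℝ) ≤ x - 2/3) (by linarith : (0:ℝ) ≤ x - 1/3)))
  have h := (((hPc.mul continuous_id'.continuousOn).mul hBc).div_const (q 1)).neg
  refine h.congr fun t _ => ?_
  simp only [hc0, hP, hH, hK, hM0, hM1, hM2, hZ, hS, Fin.cons_zero, c1, c2, c3, Pi.neg_apply, Pi.add_apply,
    Pi.sub_apply, Pi.mul_apply, Pi.div_apply, Pi.pow_apply]

end CornerTheta1

/-- **The `θ₁`-direction Newton–Leibniz move of the corner Stokes** (registered sub-goal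
`cornerStokesTheta1` of `stub_gmThreeShifted`): for `x ≥ 2`, `s ≥ 3` the representation
`N = [W, ∂θ₁c₀]` exists and `[N] ∈ KZ.relations`. Put `θ₁` last: over the base `B₁ = {(θ₂, y, v)}`
the `θ₁`-fibre of `W` is `(a, b)`, `a = max 0 (1 − θ₂ − 1/y)`, `b = min (1 − θ₂) (1/y)`; ONE rule-3 move
on the band `{a ≤ θ₁ ≤ b}` with primitive `c₀` (continuous on the closed fibres and vanishing at
both ends) gives `[band, ∂θ₁c₀] ∼ [B₁, 0] ∼ 0`; then open the fibres and permute the coordinates back.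
[cite: KontsevichZagier2001, §1.2 rule (3)] -/
theorem cornerStokesTheta1 : ∀ (x s : ℚ), 2 ≤ x → 3 ≤ s → ∀ (Z S H K M0 M1 M2 P : (Fin 4 → ℝ) → ℝ),
    (∀ w, Z w = ((1 - w 2 * (1 - w 0 - w 1)) * (1 - w 2 * w 0) * (1 - w 2 * w 1)) ^ ((1:ℝ)/3)) →
    (∀ w, S w = 1 - w 2 * ((1 - w 0 - w 1) * w 0 + (1 - w 0 - w 1) * w 1 + w 0 * w 1) +
      (w 2) ^ 2 * ((1 - w 0 - w 1) * w 0 * w 1)) →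
    (∀ w, H w = (1 + Z w + Z w ^ 2) / S w) →
    (∀ w, K w = ((1 - w 0 - w 1) * w 0 * w 1) ^ ((s:ℝ) - 1)) →
    (∀ w, M0 w = (1 - w 2 * (1 - w 0 - w 1)) ^ (x:ℝ) * (1 - w 2 * w 0) ^ ((x:ℝ) - 2/3) * (1 - w 2 * w 1) ^ ((x:ℝ) - 1/3)) →
    (∀ w, M1 w = (1 - w 2 * (1 - w 0 - w 1)) ^ ((x:ℝ) - 1/3) * (1 - w 2 * w 0) ^ (x:ℝ) * (1 - w 2 * w 1) ^ ((x:ℝ) - 2/3)) →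
    (∀ w, M2 w = (1 - w 2 * (1 - w 0 - w 1)) ^ ((x:ℝ) - 2/3) * (1 - w 2 * w 0) ^ ((x:ℝ) - 1/3) * (1 - w 2 * w 1) ^ (x:ℝ)) →
    (∀ w, P w = (w 3) ^ (3 * (x:ℝ) - 1) * (1 - w 3 * Z w) ^ (3 * (s:ℝ) - 1) * H w ^ (3 * (s:ℝ)) * K w) →
    ∀ (c0 : (Fin 4 → ℝ) → ℝ), (∀ w, c0 w = -(P w * w 0 * ((1 - w 0 - w 1) * M0 w - (1 - w 0) * M1 w + w 1 * M2 w) / w 2)) →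
    ∃ N : KZ.IntegralRep 4, N.domain = {w : Fin 4 → ℝ | 0 < w 0 ∧ 0 < w 1 ∧ w 0 + w 1 < 1 ∧ 0 < w 2 ∧ w 2 * (1 - w 0 - w 1) < 1 ∧ w 2 * w 0 < 1 ∧ w 2 * w 1 < 1 ∧ 0 < w 3 ∧ w 3 < 1} ∧
      (∀ w ∈ N.domain, HasDerivAt (fun a => c0 (Function.update w 0 a)) (N.integrand w) (w 0)) ∧
      KZ.of N ∈ KZ.relations := by
  intro x s hx hs Z S H K M0 M1 M2 P hZ hS hH hK hM0 hM1 hM2 hP c0 hc0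
  obtain ⟨d, hdsa, ⟨C, hC⟩, hd⟩ :=
    cornerStokesTheta1Aux x s hx hs Z S H K M0 M1 M2 P hZ hS hH hK hM0 hM1 hM2 hP c0 hc0
  set W : Set (Fin 4 → ℝ) := {w : Fin 4 → ℝ | 0 < w 0 ∧ 0 < w 1 ∧ w 0 + w 1 < 1 ∧ 0 < w 2 ∧
    w 2 * (1 - w 0 - w 1) < 1 ∧ w 2 * w 0 < 1 ∧ w 2 * w 1 < 1 ∧ 0 < w 3 ∧ w 3 < 1} with hW
  have hWsa : IsSemialgebraic ℚ W := CornerTheta1.isSemialgebraic_W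
  -- the base and the ends of the `θ₁`-fibres
  set B₁ : Set (Fin 3 → ℝ) := {q : Fin 3 → ℝ | 0 < q 0 ∧ q 0 < 1 ∧ 0 < q 1 ∧ q 1 * q 0 < 1 ∧
    q 1 * (1 - q 0) < 2 ∧ 0 < q 2 ∧ q 2 < 1} with hB₁
  set a : (Fin 3 → ℝ) → ℝ := fun q => max 0 (1 - q 0 - (q 1)⁻¹) with ha
  set b : (Fin 3 → ℝ) → ℝ := fun q => min (1 - q 0) (q 1)⁻¹ with hb
  have hB₁sa : IsSemialgebraic ℚ B₁ := CornerTheta1.isSemialgebraic_base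
  obtain ⟨hasa, hbsa⟩ := CornerTheta1.isSemialgebraicFunOn_ends hB₁sa
  have hab : ∀ q ∈ B₁, a q ≤ b q := by
    intro q hq
    obtain ⟨h0, h1, hy, hc, h2, -, -⟩ := hq
    have hr : q 1 * (q 1)⁻¹ = 1 := mul_inv_cancel₀ hy.ne'
    have hr0 : 0 < (q 1)⁻¹ := inv_pos.mpr hy
    refine max_le (le_min (by linarith) hr0.le) (le_min (by linarith) ?_)
    by_contra h; push Not at h
    nlinarith [mul_lt_mul_of_pos_left h hy]
  set Bd : Set (Fin 4 → ℝ) := KZlog.band B₁ a b with hBd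
  have hBdsa : IsSemialgebraic ℚ Bd := KZlog.isSemialgebraic_band hasa hbsa
  have hBdmeas : MeasurableSet Bd :=
    Literature.ModelTheory.ExponentialFields.IsSemialgebraic.measurableSet_holds hBdsa
  -- the coordinate change `z = (θ₂, y, v, θ₁) ↦ w = (θ₁, θ₂, y, v)` and the transported functions
  set ω : (Fin 4 → ℝ) → (Fin 4 → ℝ) := fun z => Fin.cons (z (Fin.last 3)) (Fin.init z) with hω
  have hωz : ∀ w : Fin 4 → ℝ, ω (fun i => w (finRotate 4 i)) = w := fun w => by
    ext j; fin_cases j <;> rfl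
  have hzω : ∀ z : Fin 4 → ℝ, (fun i => ω z (finRotate 4 i)) = z := fun z => by
    ext j; fin_cases j <;> rfl
  have hωsnoc : ∀ (q : Fin 3 → ℝ) (t : ℝ), ω (Fin.snoc q t) = Fin.cons t q := fun q t => by
    simp only [hω, Fin.snoc_last, Fin.init_snoc]
  set Wz : Set (Fin 4 → ℝ) := {z | ω z ∈ W} with hWz
  have hWzsa : IsSemialgebraic ℚ Wz := hWsa.preimage_comp ![3, 0, 1, 2]
  -- membership: `cons t q ∈ W ↔ q ∈ B₁ ∧ a q < t < b q`
  have hmem : ∀ (q : Fin 3 → ℝ) (t : ℝ), (Fin.cons t q : Fin 4 → ℝ) ∈ W ↔ q ∈ B₁ ∧ a q < t ∧ t < b q :=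
    fun q t => CornerTheta1.mem_W_iff (Fin.cons t q)
  have hWzBd : Wz ⊆ Bd := by
    intro z hz
    have h := (CornerTheta1.mem_W_iff (ω z)).mp hz
    exact ⟨h.1, h.2.1.le, h.2.2.le⟩
  set F : (Fin 4 → ℝ) → ℝ := fun z => c0 (ω z) with hF
  set f : (Fin 4 → ℝ) → ℝ := Wz.indicator fun z => d (ω z) with hf
  -- semialgebraicity of `ω`, `F`, `f`
  have hωmap : ∀ {T : Set (Fin 4 → ℝ)}, IsSemialgebraic ℚ T → IsSemialgebraicMapOn ℚ T ω := by
    intro T hT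
    refine IsSemialgebraicMapOn.of_forall hT fun j => ?_
    refine Fin.cases ?_ (fun i => ?_) j
    · exact (isSemialgebraicFunOn_apply hT (Fin.last 3)).congr fun z _ => by simp [hω]
    · exact (isSemialgebraicFunOn_apply hT (Fin.castSucc i)).congr fun z _ => by simp [hω, Fin.init]
  set σ₁ : Set (Fin 4 → ℝ) := {w | (fun i => w (finRotate 4 i)) ∈ Bd} with hσ₁
  have hσ₁sa : IsSemialgebraic ℚ σ₁ := hBdsa.preimage_comp (finRotate 4)
  have hc0σ₁ : IsSemialgebraicFunOn ℚ σ₁ c0 := by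
    refine CornerTheta1.isSemialgebraicFunOn_c0 hx hs hZ hS hH hK hM0 hM1 hM2 hP hc0 hσ₁sa fun w hw => ?_
    obtain ⟨hq, ha', hb'⟩ := hw
    obtain ⟨⟨t00, t01⟩, ⟨t10, t11⟩, ⟨t20, t21⟩, hθ0, h0, hy3, hu⟩ := CornerTheta1.band_sign hq ha' hb'
    have hy : 0 < w 2 := hq.2.2.1
    have hv0 : 0 < w 3 := hq.2.2.2.2.2.1
    have hv1 : w 3 < 1 := hq.2.2.2.2.2.2
    have hSpos : 0 < S w := by
      have key := CornerTheta1.y_mul_S hS w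
      have : 0 < w 2 * S w := by rw [key]; linarith
      exact pos_of_mul_pos_right this hy.le
    have hZle : Z w ≤ 1 := by
      rw [hZ]; exact rpow_le_one (mul_nonneg (mul_nonneg t00 t10) t20.le) hu.le (by norm_num)
    have hZ0 : 0 ≤ Z w := by rw [hZ]; exact rpow_nonneg (mul_nonneg (mul_nonneg t00 t10) t20.le) _
    exact ⟨t00, t10, t20.le, mul_nonneg (mul_nonneg hθ0 h0) hq.1.le, hSpos, hv0.le, by nlinarith, hy.ne'⟩
  have hFsa : IsSemialgebraicFunOn ℚ Bd F :=
    IsSemialgebraicFunOn.comp_isSemialgebraicMapOn_holds hc0σ₁ (hωmap hBdsa) fun z hz => by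
      show (fun i => ω z (finRotate 4 i)) ∈ Bd; rwa [hzω]
  have hfsa : IsSemialgebraicFunOn ℚ Bd f := by
    have h1 : IsSemialgebraicFunOn ℚ Wz (fun z => d (ω z)) :=
      IsSemialgebraicFunOn.comp_isSemialgebraicMapOn_holds hdsa (hωmap hWzsa) fun z hz => hz
    have h2 : IsSemialgebraicFunOn ℚ (Bd \ Wz) (fun _ => (0:ℝ)) := by
      simpa using isSemialgebraicFunOn_ratCast (hBdsa.diff hWzsa) 0
    have h := IsSemialgebraicFunOn.union (F := f) h1 h2 (fun z hz => indicator_of_mem hz _)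
      (fun z hz => indicator_of_notMem hz.2 _)
    rwa [union_sdiff_cancel hWzBd] at h
  -- fibrewise: continuity on the closed fibre, derivative on the open fibre
  have hcont : ∀ q ∈ B₁, ContinuousOn (fun t : ℝ => F (Fin.snoc q t)) (Icc (a q) (b q)) := by
    intro q hq
    simp only [hF, hωsnoc]
    exact CornerTheta1.continuousOn_c0_cons hx hs hZ hS hH hK hM0 hM1 hM2 hP hc0 hq
  have hder : ∀ q ∈ B₁, ∀ t ∈ Ioo (a q) (b q),
      HasDerivAt (fun t : ℝ => F (Fin.snoc q t)) (f (Fin.snoc q t)) t := by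
    intro q hq t ht
    have hw : (Fin.cons t q : Fin 4 → ℝ) ∈ W := (hmem q t).mpr ⟨hq, ht.1, ht.2⟩
    have hz : (Fin.snoc q t : Fin 4 → ℝ) ∈ Wz := by show ω (Fin.snoc q t) ∈ W; rwa [hωsnoc]
    simp only [hF, hf, hωsnoc, indicator_of_mem hz]
    have h := hd _ hw
    simp only [Fin.cons_zero, Fin.update_cons_zero] at h
    exact h
  -- a uniform bound and integrability of `f` on the band
  have hBdbox : Bd ⊆ Icc (0 : Fin 4 → ℝ) (fun _ => 3) := by
    intro z hz
    obtain ⟨hq, ha', hb'⟩ := hz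
    obtain ⟨-, -, -, -, h0, hy3, -⟩ := CornerTheta1.band_sign (w := ω z) hq ha' hb'
    obtain ⟨hq0, hq1, hy, -, -, hv0, hv1⟩ := hq
    have hb3 : z (Fin.last 3) ≤ 1 := (le_min_iff.mp hb').1.trans (by
      show 1 - Fin.init z 0 ≤ 1; linarith)
    refine ⟨fun i => ?_, fun i => ?_⟩
    · refine Fin.lastCases ?_ (fun j => ?_) i
      · exact h0
      · fin_cases j
        · exact hq0.le
        · exact hy.le
        · exact hv0.le
    · refine Fin.lastCases ?_ (fun j => ?_) i
      · exact hb3.trans (by norm_num)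
      · fin_cases j
        · exact hq1.le.trans (by norm_num)
        · exact hy3.le
        · exact hv1.le.trans (by norm_num)
  have hbound : ∀ z ∈ Bd, |f z| ≤ |C| := by
    intro z _
    by_cases hz : z ∈ Wz
    · rw [hf, indicator_of_mem hz]; exact (hC _ hz).trans (le_abs_self C)
    · rw [hf, indicator_of_notMem hz, abs_zero]; exact abs_nonneg C
  have hint : IntegrableOn f Bd :=
    ⟨aestronglyMeasurable_of_isSemialgebraicFunOn hfsa hBdmeas,
      HasFiniteIntegral.restrict_of_bounded (C := |C|)
        ((measure_mono hBdbox).trans_lt measure_Icc_lt_top)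
        ((ae_restrict_mem hBdmeas).mono fun z hz => by rw [Real.norm_eq_abs]; exact hbound z hz)⟩
  -- the boundary term vanishes identically
  have hbdry : ∀ q ∈ B₁, F (Fin.snoc q (b q)) - F (Fin.snoc q (a q)) = 0 := by
    intro q hq
    obtain ⟨h1, h2⟩ := CornerTheta1.c0_cons_ends hx hs hK hM0 hM1 hM2 hP hc0 (q := q) hq.2.2.1
    simp only [hF, hωsnoc, ha, hb, h1, h2, sub_zero]
  have hds : IsSemialgebraicFunOn ℚ B₁ (fun q => F (Fin.snoc q (b q)) - F (Fin.snoc q (a q))) :=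
    (isSemialgebraicFunOn_ratCast hB₁sa 0).congr fun q hq => by push_cast; exact (hbdry q hq).symm
  have hdi : IntegrableOn (fun q => F (Fin.snoc q (b q)) - F (Fin.snoc q (a q))) B₁ :=
    (integrableOn_zero).congr_fun (fun q hq => (hbdry q hq).symm)
      (Literature.ModelTheory.ExponentialFields.IsSemialgebraic.measurableSet_holds hB₁sa)
  -- the move, the opening of the fibres, the permutation of coordinates
  obtain ⟨rb, rd, hrbd, hrbi, hrdd, hrdi, hrel⟩ :=
    KZ.exists_band_newtonLeibniz hB₁sa a b hasa hbsa hab F f hFsa hfsa hcont hder hint hds hdi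
  obtain ⟨r', hr'd, hr'i, hr'rel⟩ := KZ.of_sub_of_restrict_openBand_mem_relations hasa hbsa rb hrbd
  have hrd0 : KZ.of rd ∈ KZ.relations := by
    refine KZ.of_mem_relations_of_eqOn_zero rd fun q hq => ?_
    rw [hrdd] at hq
    rw [hrdi]
    exact hbdry q hq
  refine ⟨r'.reindex (finRotate 4), ?_, ?_, ?_⟩
  · ext w
    simp only [IntegralRep.reindex_domain, hr'd, mem_setOf_eq]
    rw [← hωz w, hmem]
    exact Iff.rfl
  · intro w hw
    simp only [IntegralRep.reindex_domain, hr'd, mem_setOf_eq] at hw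
    have hw' : w ∈ W := by rw [← hωz w, hmem]; exact hw
    have hz : (fun i => w (finRotate 4 i)) ∈ Wz := by
      show ω (fun i => w (finRotate 4 i)) ∈ W; rwa [hωz]
    simp only [IntegralRep.reindex_integrand, hr'i, hrbi, hf, indicator_of_mem hz, hωz]
    exact hd w hw'
  · have hre := KZ.of_sub_of_reindex_mem_relations r' (finRotate 4)
    have : KZ.of (r'.reindex (finRotate 4)) =
        (KZ.of rb - KZ.of rd) + KZ.of rd - (KZ.of rb - KZ.of r') - (KZ.of r' - KZ.of (r'.reindex (finRotate 4))) := by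
      abel
    rw [this]
    exact KZ.relations.sub_mem (KZ.relations.sub_mem (KZ.relations.add_mem hrel hrd0) hr'rel) hre

end Summit.KontsevichZagierPeriods.TerasomaMultiplication.MultiplicationAccessible

end
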